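import Summits.BirchSwinnertonDyer.Rank1Residual.Supersingular.BlindPointDerivAt
import Literature.NumberTheory.EllipticCurves.IwasawaAlgebraProofs
import Literature.NumberTheory.EllipticCurves.IwasawaAlgebraCharIdealProofs
import Mathlib.LinearAlgebra.Matrix.Charpoly.LinearMap
import HarnessLib

/-!
# Route `ByReductionTypeAtTwo` (rung K4), crux `SupersingularRankZeroAtTwo` (item
# stmt-BirchSwinnertonDyer-19097), line `signed_halves_two` v3: the `Λ`-algebra behind the ORDER-2
# CHARACTER — factor theorem on the open disc, height-one Nakayama, `T + 2` prime in `ℤ₂⟦T⟧`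
# (seat `bsd-2adic-ss-1`, GEN 6; tools for `ByReductionTypeAtTwoSupersingularOrderTwoCoinvariants`)

HONEST FRAMING (cell `bsd-2adic`, run/shared/lean/pub/bsd-2adic/, HUMAN RULINGS D-0036/D-0059/D-0074):
pure commutative algebra over the Iwasawa algebra `Λ = ℤ_p⟦T⟧`; THEOREMS ONLY, no definition, no named
fact, no `sorry`; nothing booked; BSD is not proved by any of this. PARTITION (D-0054): X5@2 good-ss
(B1·O1), `a₂ = 0` sub-row (208 r0 book230 classes) × p = 2 — types-the-object-of (tools); closes none.
bears_on: K4 (route-BirchSwinnertonDyer-ByReductionTypeAtTwo item 19097).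

## What is proved

* §1 `exists_eq_X_sub_C_mul_add_C_evalAt`, `X_sub_C_dvd_of_evalAt_eq_zero` — **factor theorem on the
  open unit disc**: for `‖t‖ < 1` and `g ∈ ℤ_p⟦T⟧`, `g = (T − t)·q + g(t)` with `q_k = Σ_j g_{j+k+1} t^j`
  (`BlindLever.evalAt`), hence `g(t) = 0 ⇒ (T − t) ∣ g`.
* §2 `not_finite_quotient_of_prime_dvd_charGenerator` — **height-one Nakayama, any `p`**: `M` a
  finitely generated torsion `Λ`-module with `char(M) = (f)`, `π` a prime element of `Λ` with `π ∤ p` and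
  `π ∣ f` ⇒ `M ⧸ πM` is INFINITE. (`(π)` is a height-one prime containing `char(M) = ∏ 𝔮^{ℓ_𝔮}`, so
  it is some `𝔮` of the support — comparable height-one primes are equal — and `M_{(π)} ≠ 0`; if `M/πM`
  had finite order `c` then `c·M ⊆ πM`, the determinant trick gives `q(c)·M = 0` with `q` monic and
  lower coefficients in `(π)`, and `π ∤ c` puts `q(c)` outside `(π)`, i.e. `M_{(π)} = 0`.) Greenberg's
  Lemma 4.2 (LNM 1716) is the case `π = T`; this is the same statement at any height-one prime `(π)`,
  `π ∤ p`, in the direction "`π ∣ char ⇒` infinite coinvariants".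
* §3 `prime_X_add_C_two` (`(T+2) = ker(ev_{−2})`, by §1), `not_X_add_C_two_dvd_C_two` — `T + 2` is a
  prime element of `ℤ₂⟦T⟧` not dividing `2`: the height-one prime of the ORDER-2 character
  `γ ↦ −1` of `Γ ≅ ℤ₂` (`T = γ − 1 ↦ −2`), which exists only at `p = 2` (Greenberg, LNM 1716 p. 181).

References: R. Greenberg, LNM 1716 (1999) §4 Lemma 4.2 and p. 181 [GreenbergLNM1716]; L. Washington,
GTM 83 §13.2 [Washington1997]; H. Matsumura, Commutative Ring Theory, Thm. 2.1 (determinant trick).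
-/

set_option autoImplicit false
-- the Theorems namespace of this sub repeats the summit name by design (D-0017 nested layout)
set_option linter.dupNamespace false

noncomputable section

open scoped Classical

open Literature.NumberTheory.EllipticCurves Summit.BirchSwinnertonDyer.Rank1Residual.Supersingular
  Summit.BirchSwinnertonDyer.Rank1Residual.Supersingular.BlindLever

namespace Summit.BirchSwinnertonDyer.BirchSwinnertonDyer.Theorems

/-! ## §1 Factor theorem for evaluation on the open unit disc -/

section Factor

variable {p : ℕ} [Fact p.Prime]

/-- The shifted series `Σ_j g_{j+m} t^j` converges on the open disc. [folklore] -/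
theorem summable_coeff_shift_mul_pow {t : ℤ_[p]} (ht : ‖t‖ < 1) (g : PowerSeries ℤ_[p]) (m : ℕ) :
    Summable fun j ↦ PowerSeries.coeff (j + m) g * t ^ j :=
  summable_mul_pow ht _

/-- Shift identity: `Σ_j g_{j+m} t^j = g_m + t · Σ_j g_{j+m+1} t^j`. [folklore] -/
theorem tsum_coeff_shift_eq {t : ℤ_[p]} (ht : ‖t‖ < 1) (g : PowerSeries ℤ_[p]) (m : ℕ) :
    ∑' j, PowerSeries.coeff (j + m) g * t ^ j =
      PowerSeries.coeff m g + t * ∑' j, PowerSeries.coeff (j + (m + 1)) g * t ^ j := by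
  rw [(summable_coeff_shift_mul_pow ht g m).tsum_eq_zero_add]
  simp only [zero_add, pow_zero, mul_one]
  congr 1
  rw [← (summable_coeff_shift_mul_pow ht g (m + 1)).tsum_mul_left t]
  refine tsum_congr fun j ↦ ?_
  rw [show j + 1 + m = j + (m + 1) by ring, pow_succ]
  ring

/-- **Taylor remainder at a point of the open disc**: `g = (T − t)·q + g(t)` for some `q ∈ ℤ_p⟦T⟧`
(explicitly `q_k = Σ_j g_{j+k+1} t^j`). [folklore] -/
theorem exists_eq_X_sub_C_mul_add_C_evalAt {t : ℤ_[p]} (ht : ‖t‖ < 1) (g : PowerSeries ℤ_[p]) :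
    ∃ q : PowerSeries ℤ_[p],
      g = (PowerSeries.X - PowerSeries.C t) * q + PowerSeries.C (BlindLever.evalAt t g) := by
  refine ⟨PowerSeries.mk fun k ↦ ∑' j, PowerSeries.coeff (j + (k + 1)) g * t ^ j, ?_⟩
  ext n
  rcases n with _ | n
  · -- constant coefficient
    have hev : BlindLever.evalAt t g = ∑' j, PowerSeries.coeff (j + 0) g * t ^ j := by
      simp only [BlindLever.evalAt, add_zero]
    rw [map_add, sub_mul, map_sub, PowerSeries.coeff_zero_X_mul, PowerSeries.coeff_C_mul,
      PowerSeries.coeff_mk, PowerSeries.coeff_zero_C, hev, tsum_coeff_shift_eq ht g 0]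
    ring
  · -- coefficient `n + 1`
    rw [map_add, PowerSeries.coeff_C, if_neg (Nat.succ_ne_zero n), add_zero, sub_mul, map_sub,
      PowerSeries.coeff_succ_X_mul, PowerSeries.coeff_C_mul, PowerSeries.coeff_mk,
      PowerSeries.coeff_mk, tsum_coeff_shift_eq ht g (n + 1)]
    ring

/-- **Factor theorem on the open disc**: `‖t‖ < 1`, `g(t) = 0` ⇒ `(T − t) ∣ g` in `ℤ_p⟦T⟧`.
[folklore] -/
theorem X_sub_C_dvd_of_evalAt_eq_zero {t : ℤ_[p]} (ht : ‖t‖ < 1) {g : PowerSeries ℤ_[p]}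
    (hg : BlindLever.evalAt t g = 0) : (PowerSeries.X - PowerSeries.C t) ∣ g := by
  obtain ⟨q, h⟩ := exists_eq_X_sub_C_mul_add_C_evalAt ht g
  refine ⟨q, ?_⟩
  rwa [hg, map_zero, add_zero] at h

end Factor

/-! ## §2 A prime element of `Λ` dividing the characteristic power series has infinite coinvariants -/

section Nakayama

open Literature.NumberTheory.EllipticCurves.Module

variable {p : ℕ} [Fact p.Prime]
variable {M : Type*} [AddCommGroup M] [Module (IwasawaAlgebra p) M]

/-- If `r • m = 0` for every `m` with `r ∉ 𝔭` then the local length of `M` at `𝔭` vanishes.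
[folklore] -/
theorem lengthAt_eq_zero_of_forall_smul_eq_zero {r : IwasawaAlgebra p}
    (𝔭 : PrimeSpectrum (IwasawaAlgebra p)) (hr : r ∉ 𝔭.asIdeal) (h : ∀ m : M, r • m = 0) :
    lengthAt (IwasawaAlgebra p) M 𝔭 = 0 :=
  lengthAt_eq_zero_of_isTorsionBy (fun m ↦ h m) 𝔭 hr

/-- A natural number, viewed in `Λ = ℤ_p⟦T⟧`, is `p^a` times a unit; so a prime element of `Λ` not
dividing `p` divides no non-zero natural number. [folklore] -/
theorem not_dvd_natCast_of_not_dvd_C {π : IwasawaAlgebra p} (hπ : Prime π)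
    (hπp : ¬ π ∣ PowerSeries.C (p : ℤ_[p])) {c : ℕ} (hc : c ≠ 0) :
    ¬ π ∣ (c : IwasawaAlgebra p) := by
  -- write `c = p^a * b` with `p ∤ b`
  obtain ⟨a, b, hb, rfl⟩ :=
    Nat.exists_eq_pow_mul_and_not_dvd hc p (Nat.Prime.one_lt (Fact.out : p.Prime)).ne'
  intro hdvd
  have hbunit : IsUnit ((b : ℤ) : ℤ_[p]) := by
    rw [PadicInt.isUnit_iff]
    have hlt : ¬ ‖((b : ℤ) : ℤ_[p])‖ < 1 := by
      rw [PadicInt.norm_int_lt_one_iff_dvd]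
      exact_mod_cast hb
    exact le_antisymm (PadicInt.norm_le_one _) (not_lt.mp hlt)
  have hbunit' : IsUnit (PowerSeries.C (b : ℤ_[p]) : IwasawaAlgebra p) := by
    have : ((b : ℤ) : ℤ_[p]) = (b : ℤ_[p]) := by push_cast; rfl
    rw [← this]
    exact hbunit.map PowerSeries.C
  have hcast : ((p ^ a * b : ℕ) : IwasawaAlgebra p) =
      (PowerSeries.C (p : ℤ_[p])) ^ a * PowerSeries.C (b : ℤ_[p]) := by
    rw [← map_pow, ← map_mul, ← map_natCast (PowerSeries.C (R := ℤ_[p]))]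
    push_cast
    rfl
  rw [hcast] at hdvd
  rcases hπ.dvd_or_dvd hdvd with h1 | h2
  · exact hπp (hπ.dvd_of_dvd_pow h1)
  · exact hπ.not_unit (isUnit_of_dvd_unit h2 hbunit')

/-- **Height-one Nakayama**: `M` a finitely generated torsion `Λ`-module with `char(M) = (f)`, `π` a
prime element of `Λ` with `π ∤ p` and `π ∣ f`. Then `M ⧸ πM` is INFINITE. Proof: `𝔭 = (π)` is a
height-one prime (Krull) and `(f) ⊆ 𝔭` forces `𝔭` into the (finite) height-one support of `M`
(`char` is the product of `𝔮^{ℓ_𝔮}` over that support; a prime containing the product contains some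
`𝔮` with `ℓ_𝔮 ≠ 0`, and comparable height-one primes are equal), so `M_𝔭 ≠ 0`; if `M/πM` were
finite of order `c` then `c·M ⊆ πM`, and the determinant trick (Matsumura Thm. 2.1) applied to
multiplication by `c` yields `r ≡ cⁿ (mod π)` with `r·M = 0`; as `π ∤ c`, `r ∉ 𝔭` and `M_𝔭 = 0` —
contradiction. (Washington §13.2; Greenberg LNM 1716 Lemma 4.2 is the case `π = T`.)
[cite: Washington1997, §13.2] [cite: GreenbergLNM1716, §4 Lemma 4.2] -/
theorem not_finite_quotient_of_prime_dvd_charGenerator [Module.Finite (IwasawaAlgebra p) M]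
    (hM : Module.IsTorsion (IwasawaAlgebra p) M) {π f : IwasawaAlgebra p} (hπ : Prime π)
    (hπp : ¬ π ∣ PowerSeries.C (p : ℤ_[p]))
    (hf : charIdeal (IwasawaAlgebra p) M = Ideal.span {f}) (hdvd : π ∣ f) :
    ¬ Finite (M ⧸ (Ideal.span {π} • ⊤ : Submodule (IwasawaAlgebra p) M)) := by
  classical
  intro hfin
  haveI hprime : (Ideal.span {π} : Ideal (IwasawaAlgebra p)).IsPrime :=
    (Ideal.span_singleton_prime hπ.ne_zero).mpr hπ
  let 𝔭 : PrimeSpectrum (IwasawaAlgebra p) := ⟨Ideal.span {π}, hprime⟩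
  have h𝔭1 : 𝔭.asIdeal.height = 1 := height_span_singleton_eq_one_of_prime hπ
  -- Step A: the local length of `M` at `𝔭` is non-zero
  have hlen : lengthAt (IwasawaAlgebra p) M 𝔭 ≠ 0 := by
    intro h0
    obtain ⟨s, hsann, hs0⟩ := Submodule.annihilator_top_inter_nonZeroDivisors hM
    have hs : s ≠ 0 := nonZeroDivisors.ne_zero hs0
    have hsM : Module.IsTorsionBy (IwasawaAlgebra p) M s := fun x ↦
      Submodule.mem_annihilator.mp hsann x Submodule.mem_top
    set F : PrimeSpectrum (IwasawaAlgebra p) → Ideal (IwasawaAlgebra p) :=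
      fun 𝔮 ↦ 𝔮.asIdeal ^ (lengthAt (IwasawaAlgebra p) M 𝔮).toNat with hF
    have hfinsupp := finite_heightOne_inter_mulSupport hs hsM
    set t : Finset (PrimeSpectrum (IwasawaAlgebra p)) := hfinsupp.toFinset with ht
    have hchar : charIdeal (IwasawaAlgebra p) M = ∏ 𝔮 ∈ t, F 𝔮 := by
      unfold charIdeal
      refine finprod_mem_eq_prod_of_inter_mulSupport_eq F ?_
      rw [ht, Set.Finite.coe_toFinset, Set.inter_assoc, Set.inter_self]
    -- `(f) ≤ 𝔭`
    have hle : charIdeal (IwasawaAlgebra p) M ≤ 𝔭.asIdeal := by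
      rw [hf, Ideal.span_singleton_le_iff_mem]
      exact Ideal.mem_span_singleton.mpr hdvd
    rw [hchar] at hle
    obtain ⟨𝔮, h𝔮t, h𝔮le⟩ := (Ideal.IsPrime.prod_le hprime).mp hle
    rw [ht, Set.Finite.mem_toFinset] at h𝔮t
    obtain ⟨h𝔮1, h𝔮supp⟩ := h𝔮t
    simp only [Set.mem_setOf_eq] at h𝔮1
    -- the exponent at `𝔮` is non-zero (else `𝔮` is not in the support)
    have hn : (lengthAt (IwasawaAlgebra p) M 𝔮).toNat ≠ 0 := by
      intro hn
      rw [Function.mem_mulSupport] at h𝔮supp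
      exact h𝔮supp (by rw [hn, pow_zero])
    have h𝔮𝔭 : 𝔮.asIdeal ≤ 𝔭.asIdeal := Ideal.IsPrime.le_of_pow_le h𝔮le
    -- comparable height-one primes are equal
    have heq : 𝔮.asIdeal = 𝔭.asIdeal := by
      by_contra hne
      have hlt : 𝔮.asIdeal < 𝔭.asIdeal := lt_of_le_of_ne h𝔮𝔭 hne
      have h2 := Ideal.height_add_one_le_of_lt_of_isPrime hlt
      rw [h𝔮1, h𝔭1] at h2
      exact absurd h2 (by norm_num)
    have h𝔮eq : 𝔮 = 𝔭 := PrimeSpectrum.ext heq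
    rw [h𝔮eq, h0] at hn
    exact hn rfl
  -- Step B: finiteness of `M/πM` forces `M_𝔭 = 0`
  apply hlen
  haveI : Finite (M ⧸ (Ideal.span {π} • ⊤ : Submodule (IwasawaAlgebra p) M)) := hfin
  set c : ℕ := Nat.card (M ⧸ (Ideal.span {π} • ⊤ : Submodule (IwasawaAlgebra p) M)) with hc
  have hcpos : c ≠ 0 := Nat.card_pos.ne'
  -- `c • M ⊆ π M`
  have hrange : LinearMap.range ((c : IwasawaAlgebra p) • (LinearMap.id : M →ₗ[IwasawaAlgebra p] M)) ≤
      (Ideal.span {π} : Ideal (IwasawaAlgebra p)) • (⊤ : Submodule (IwasawaAlgebra p) M) := by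
    rintro x ⟨m, rfl⟩
    rw [← Submodule.Quotient.mk_eq_zero, LinearMap.smul_apply, LinearMap.id_apply,
      Submodule.Quotient.mk_smul, Nat.cast_smul_eq_nsmul, hc]
    exact card_nsmul_eq_zero'
  obtain ⟨q, hqmonic, -, hqcoeff, hqaeval⟩ :=
    LinearMap.exists_monic_and_natDegree_eq_and_coeff_mem_pow_and_aeval_eq_zero (IwasawaAlgebra p)
      ((c : IwasawaAlgebra p) • (LinearMap.id : M →ₗ[IwasawaAlgebra p] M)) (Ideal.span {π}) hrange
  -- `r := q(c)` kills `M`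
  have hkill : ∀ m : M, (q.eval (c : IwasawaAlgebra p)) • m = 0 := by
    intro m
    have h1 : ((c : IwasawaAlgebra p) • (LinearMap.id : M →ₗ[IwasawaAlgebra p] M)) =
        algebraMap (IwasawaAlgebra p) (Module.End (IwasawaAlgebra p) M) (c : IwasawaAlgebra p) := by
      rw [Module.algebraMap_end_eq_smul_id]
    have h2 := LinearMap.congr_fun hqaeval m
    rw [h1, Polynomial.aeval_algebraMap_apply_eq_algebraMap_eval, Module.algebraMap_end_apply,
      LinearMap.zero_apply] at h2
    exact h2
  -- `q(c) ≡ c^n (mod π)`, hence `q(c) ∉ 𝔭`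
  have hr𝔭 : q.eval (c : IwasawaAlgebra p) ∉ 𝔭.asIdeal := by
    intro hrmem
    have hsum : q.eval (c : IwasawaAlgebra p) =
        ∑ k ∈ Finset.range (q.natDegree + 1), q.coeff k * (c : IwasawaAlgebra p) ^ k :=
      Polynomial.eval_eq_sum_range (p := q) _
    -- all terms with `k < natDegree` lie in `(π)`
    have hlow : ∑ k ∈ Finset.range q.natDegree, q.coeff k * (c : IwasawaAlgebra p) ^ k ∈ 𝔭.asIdeal := by
      refine Ideal.sum_mem _ fun k hk ↦ Ideal.mul_mem_right _ _ ?_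
      have hk' : q.natDegree - k ≠ 0 := Nat.sub_ne_zero_of_lt (Finset.mem_range.mp hk)
      exact Ideal.pow_le_self hk' (hqcoeff k)
    rw [Finset.sum_range_succ, hqmonic.coeff_natDegree, one_mul] at hsum
    have htop : (c : IwasawaAlgebra p) ^ q.natDegree ∈ 𝔭.asIdeal := by
      have h3 : q.eval (c : IwasawaAlgebra p) -
          ∑ k ∈ Finset.range q.natDegree, q.coeff k * (c : IwasawaAlgebra p) ^ k ∈ 𝔭.asIdeal :=
        Ideal.sub_mem _ hrmem hlow
      rwa [hsum, add_sub_cancel_left] at h3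
    have hπc : π ∣ (c : IwasawaAlgebra p) ^ q.natDegree := Ideal.mem_span_singleton.mp htop
    exact not_dvd_natCast_of_not_dvd_C hπ hπp hcpos (hπ.dvd_of_dvd_pow hπc)
  exact lengthAt_eq_zero_of_forall_smul_eq_zero 𝔭 hr𝔭 hkill

end Nakayama

/-! ## §3 `T + 2` is a prime element of `ℤ₂⟦T⟧` not dividing `2` -/

section TwoAdic

/-- `(T + 2)(−2) = 0`. [folklore] -/
theorem evalAt_neg_two_X_add_C_two :
    BlindLever.evalAt (-2 : ℤ_[2]) (PowerSeries.X + PowerSeries.C (2 : ℤ_[2])) = 0 := by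
  rw [evalAt_add norm_neg_two_lt_one, evalAt_X, evalAt_C]
  ring

/-- The ideal `(T + 2)` of `ℤ₂⟦T⟧` is the kernel of evaluation at `−2` (factor theorem + `(T+2)(−2) = 0`).
[folklore] -/
theorem span_X_add_C_two_eq_ker_evalAtHom :
    (Ideal.span {PowerSeries.X + PowerSeries.C (2 : ℤ_[2])} : Ideal (PowerSeries ℤ_[2])) =
      RingHom.ker (evalAtHom norm_neg_two_lt_one) := by
  apply le_antisymm
  · rw [Ideal.span_singleton_le_iff_mem, RingHom.mem_ker]
    exact evalAt_neg_two_X_add_C_two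
  · intro g hg
    rw [RingHom.mem_ker] at hg
    have h := X_sub_C_dvd_of_evalAt_eq_zero norm_neg_two_lt_one (g := g) hg
    rw [map_neg, sub_neg_eq_add] at h
    exact Ideal.mem_span_singleton.mpr h

/-- **`T + 2` is a prime element of `Λ = ℤ₂⟦T⟧`** (`Λ/(T+2) ≅ ℤ₂` via `T ↦ −2`). [folklore] -/
theorem prime_X_add_C_two : Prime (PowerSeries.X + PowerSeries.C (2 : ℤ_[2]) : PowerSeries ℤ_[2]) := by
  have hne : (PowerSeries.X + PowerSeries.C (2 : ℤ_[2]) : PowerSeries ℤ_[2]) ≠ 0 := by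
    intro h
    have h1 := congrArg (PowerSeries.coeff 1) h
    rw [map_add, PowerSeries.coeff_one_X, PowerSeries.coeff_C, if_neg one_ne_zero, map_zero,
      add_zero] at h1
    exact one_ne_zero h1
  rw [← Ideal.span_singleton_prime hne, span_X_add_C_two_eq_ker_evalAtHom]
  exact RingHom.ker_isPrime _

/-- **`T + 2 ∤ 2` in `ℤ₂⟦T⟧`** (comparing the coefficients of `T⁰` and `T¹` would make `2` a unit
of `ℤ₂`). [folklore] -/
theorem not_X_add_C_two_dvd_C_two :
    ¬ (PowerSeries.X + PowerSeries.C (2 : ℤ_[2]) : PowerSeries ℤ_[2]) ∣ PowerSeries.C ((2 : ℕ) : ℤ_[2]) := by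
  rintro ⟨q, hq⟩
  rw [Nat.cast_ofNat] at hq
  have h0 := congrArg (PowerSeries.coeff 0) hq
  have h1 := congrArg (PowerSeries.coeff 1) hq
  rw [PowerSeries.coeff_zero_C, add_mul, map_add, PowerSeries.coeff_zero_X_mul,
    PowerSeries.coeff_C_mul, zero_add] at h0
  rw [PowerSeries.coeff_C, if_neg one_ne_zero, add_mul, map_add, PowerSeries.coeff_succ_X_mul,
    PowerSeries.coeff_C_mul] at h1
  -- `h0 : 2 = 2 * q₀`, `h1 : 0 = q₀ + 2 * q₁`
  have h2 : (2 : ℤ_[2]) ≠ 0 := by exact_mod_cast (two_ne_zero : (2 : ℤ) ≠ 0)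
  have hq0 : PowerSeries.coeff 0 q = 1 := by
    have h3 : (2 : ℤ_[2]) * (PowerSeries.coeff 0 q - 1) = 0 := by rw [mul_sub, ← h0]; ring
    rcases mul_eq_zero.mp h3 with h | h
    · exact absurd h h2
    · exact sub_eq_zero.mp h
  rw [hq0] at h1
  have hunit : IsUnit (2 : ℤ_[2]) := by
    refine IsUnit.of_mul_eq_one (-(PowerSeries.coeff 1 q)) ?_
    linear_combination h1
  have hlt : ‖(2 : ℤ_[2])‖ < 1 := by
    have h4 : ‖((2 : ℕ) : ℤ_[2])‖ < 1 := (PadicInt.norm_lt_one_iff_dvd _).mpr dvd_rfl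
    simpa using h4
  exact absurd (PadicInt.isUnit_iff.mp hunit) (ne_of_lt hlt)

end TwoAdic

end Summit.BirchSwinnertonDyer.BirchSwinnertonDyer.Theorems

end
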